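import Literature.Geometry.Manifold.RegularValuesReal
import Literature.Geometry.Manifold.SmoothExhaustionFunction
import Literature.Geometry.Riemannian.GaussBonnetGradient
import HarnessLib

/-!
# Smooth relatively compact regular sublevel domains containing a compact set

Topic `Geometry/Riemannian` (general infrastructure, used by the Neumann form of the glue for
`Literature.Geometry.Riemannian.sharpLogSobolevAVR_four`, file `SharpLogSobolevAVRNeumann.lean`).
On a Hausdorff second countable `C^∞` manifold `M` modelled on `ℝᵐ`, every compact `K ⊆ M` is
contained in a **smooth relatively compact domain with regular boundary**: there is a `C^∞`
function `σ : M → ℝ` with `K ⊆ {σ < 0}`, `{σ ≤ 0}` compact, `{σ < 0} ≠ ∅` (if `M ≠ ∅`) and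
`dσ ≠ 0` on `{σ = 0}` — so that `D = {σ < 0}` is an open set with compact closure `{σ ≤ 0}` and
smooth boundary `{σ = 0}` (a regular level set). Construction (Milnor 1965, §2–§3; Lee 2013,
Prop. 2.28 with Sard's theorem): a smooth exhaustion function `ρ`
(`Literature.Geometry.Manifold.exists_contMDiff_isCompact_preimage_Iic`) and a regular value `s`
of `ρ` slightly above `max_K ρ` (Sard–Brown for real functions on manifolds,
`Literature.Geometry.Manifold.exists_mem_Ioo_forall_mfderiv_ne_zero`); `σ = ρ - s`.

* `exists_regular_sublevel_domain` — the statement above (`mvfderiv σ ≠ 0` on `{σ = 0}`).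
* `gradSq_pos_of_mvfderiv_ne_zero` — for a Riemannian metric, `|∇f|² > 0` where `df ≠ 0`.
* `exists_regular_sublevel_domain_gradSq` — the Riemannian form (`|∇σ|²_g > 0` on `{σ = 0}`),
  the shape consumed by `exists_interior_min_of_neumann` / `sharpLogSobolevAVR_four_of_neumann`.

Pure proofs; no definitions, no named facts.

## References

* J. Milnor, *Topology from the Differentiable Viewpoint* (1965), §2 Lemma 1 p. 11 (regular
  level sets), §3 p. 16–17 (Sard, Brown). [MilnorTDV1965]
* J. M. Lee, *Introduction to Smooth Manifolds*, 2nd ed. (2013), Prop. 2.28 (exhaustion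
  functions); cf. Thm. 6.10 and Prop. 5.47 (regular sublevel sets are regular domains).
  [LeeSmoothManifolds2013]
-/

noncomputable section

open Set Function Filter
open scoped Manifold ContDiff Topology

namespace Literature.Geometry.Riemannian

open Literature.Geometry.Manifold

section Domain

variable {m : ℕ} {M : Type*} [TopologicalSpace M] [ChartedSpace (EuclideanSpace ℝ (Fin m)) M]
  [IsManifold (𝓡 m) ∞ M] [T2Space M] [SecondCountableTopology M]

/-- **Smooth relatively compact regular domains containing a compact set** (Milnor 1965 §3 with
Lee 2013 Prop. 2.28). On a nonempty Hausdorff second countable `C^∞` manifold modelled on `ℝᵐ`,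
for every compact `K` there is a `C^∞` function `σ` with `K ⊆ {σ < 0}`, `{σ ≤ 0}` compact,
`{σ < 0}` nonempty and `dσ_x ≠ 0` whenever `σ x = 0`: `σ = ρ - s` for a smooth exhaustion
function `ρ` and a regular value `s ∈ (T₀, T₀ + 1)` of `ρ`, `T₀ = max (ρ(K ∪ {x₀}))`.
[cite: MilnorTDV1965, §3, Corollary (Brown) p. 17] [cite: LeeSmoothManifolds2013, Prop. 2.28] -/
theorem exists_regular_sublevel_domain [Nonempty M] {K : Set M} (hK : IsCompact K) :
    ∃ σ : M → ℝ, ContMDiff (𝓡 m) 𝓘(ℝ, ℝ) ∞ σ ∧ K ⊆ {x | σ x < 0} ∧ IsCompact {x | σ x ≤ 0} ∧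
      (∃ x, σ x < 0) ∧ ∀ x, σ x = 0 → mvfderiv (𝓡 m) σ x ≠ 0 := by
  haveI : LocallyCompactSpace M := Manifold.locallyCompact_of_finiteDimensional (𝓡 m)
  haveI : SigmaCompactSpace M := sigmaCompactSpace_of_locallyCompact_secondCountable
  obtain ⟨ρ, hρ, -, hρc⟩ := exists_contMDiff_isCompact_preimage_Iic (I := 𝓡 m) (M := M)
  obtain ⟨x₀⟩ := ‹Nonempty M›
  -- a level above `K ∪ {x₀}`
  have hK' : IsCompact (insert x₀ K) := hK.insert x₀
  obtain ⟨T₀, hT₀⟩ : ∃ T₀ : ℝ, ∀ x ∈ insert x₀ K, ρ x ≤ T₀ := by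
    obtain ⟨B, hB⟩ := hK'.bddAbove_image hρ.continuous.continuousOn
    exact ⟨B, fun x hx ↦ hB (mem_image_of_mem _ hx)⟩
  -- a regular value in `(T₀, T₀ + 1)`
  obtain ⟨s, hs, hreg⟩ := exists_mem_Ioo_forall_mfderiv_ne_zero hρ (hρc (T₀ + 1))
    (show T₀ < T₀ + 1 by linarith)
  refine ⟨fun x ↦ ρ x - s, hρ.sub contMDiff_const, fun x hx ↦ ?_, ?_, ⟨x₀, ?_⟩, fun x hx ↦ ?_⟩
  · show ρ x - s < 0
    linarith [hT₀ x (mem_insert_of_mem _ hx), hs.1]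
  · have : {x | ρ x - s ≤ 0} = ρ ⁻¹' Iic s := by
      ext x; simp only [mem_setOf_eq, mem_preimage, mem_Iic]; constructor <;> intro h <;> linarith
    rw [this]; exact hρc s
  · show ρ x₀ - s < 0
    linarith [hT₀ x₀ (mem_insert _ _), hs.1]
  · have hρx : ρ x = s := by linarith
    have hxC : x ∈ ρ ⁻¹' Iic (T₀ + 1) := by
      show ρ x ≤ T₀ + 1
      linarith [hs.2]
    have h := hreg x hxC hρx
    have hd : mvfderiv (𝓡 m) (fun x ↦ ρ x - s) x = mvfderiv (𝓡 m) ρ x := by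
      rw [mvfderiv_fun_sub ((hρ x).mdifferentiableAt (by simp)) mdifferentiableAt_const,
        mvfderiv_const, sub_zero]
    rw [hd]
    intro h0
    apply h
    ext v
    have := DFunLike.congr_fun h0 v
    exact this

variable (g : Lorentzian.PseudoRiemannianMetric (𝓡 m) ∞ (EuclideanSpace ℝ (Fin m))
  (TangentSpace (𝓡 m) : M → Type _))

omit [T2Space M] [SecondCountableTopology M] in
/-- For a Riemannian metric, `|∇f|²_g (x) > 0` at every point where `df_x ≠ 0` (`∇f = ♯ df`,
`♯` injective, positivity of `g`). [folklore] -/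
theorem gradSq_pos_of_mvfderiv_ne_zero (hg : g.IsRiemannian) {f : M → ℝ} {x : M}
    (hx : mvfderiv (𝓡 m) f x ≠ 0) : 0 < g.gradSq f x := by
  have hgrad : grad g f x ≠ 0 := fun h ↦ by
    rw [grad_apply, LinearEquiv.map_eq_zero_iff] at h
    exact hx (by ext v; exact LinearMap.congr_fun h v)
  have h1 : g.gradSq f x = g.val x (grad g f x) (grad g f x) := by
    rw [val_grad]; rfl
  rw [h1]
  exact hg x _ hgrad

/-- **Smooth relatively compact regular domains, Riemannian form**: as
`exists_regular_sublevel_domain`, with the regularity of the boundary expressed as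
`|∇σ|²_g > 0` on `{σ = 0}`. [cite: MilnorTDV1965, §3, Corollary (Brown) p. 17] -/
theorem exists_regular_sublevel_domain_gradSq [Nonempty M] (hg : g.IsRiemannian) {K : Set M}
    (hK : IsCompact K) :
    ∃ σ : M → ℝ, ContMDiff (𝓡 m) 𝓘(ℝ, ℝ) ∞ σ ∧ K ⊆ {x | σ x < 0} ∧ IsCompact {x | σ x ≤ 0} ∧
      (∃ x, σ x < 0) ∧ ∀ x, σ x = 0 → 0 < g.gradSq σ x := by
  obtain ⟨σ, hσ, hK', hc, hne, hreg⟩ := exists_regular_sublevel_domain (m := m) hK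
  exact ⟨σ, hσ, hK', hc, hne, fun x hx ↦ gradSq_pos_of_mvfderiv_ne_zero g hg (hreg x hx)⟩

end Domain

end Literature.Geometry.Riemannian
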